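/-
Copyright: lead seat `ym-line-sll-p1` (prover-ym-line-sll-p1-g0-0), route `SoftLoopLongLag`, crux `SoftLoopLagFloorToTorus`
(stmt-QuantumFields-22504), line `birth`.
-/
import Summits.QuantumFields.YangMills.Theorems.SoftLoopLongLagDefs
import Literature.MathematicalPhysics.QuantumLattice.WilsonLoopsProofs
import Literature.MathematicalPhysics.QuantumFieldTheory.StringTensionAnalysis

/-!
# Registered stub K5 `stub_limitPassageG` of crux `SoftLoopLagFloorToTorus` (stmt-QuantumFields-22504), line `birth` — PROVED:
# an eventual torus floor on the lag-`R` autocovariance of the soft-loop observable passes to every torus-limit state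

WHAT.  For a compact group `G` (Borel structure an instance), a lattice representation `r`, a coupling `β`, a side `R` and a level
`θ`: if eventually in the torus side `L` the torus Wilson state has `θ ≤ torusLagCov r β L F_R R` (`F_R = softLoopObs r R`, the
cube-smeared time-zero soft-loop observable), then every `μ ∈ infiniteVolumeLimitPoints r.ρ β` has `θ ≤ rpCorr μ F_R R` and
`rpCorr μ F_R 0 ≤ (2R+1)⁸`.  Ingredients: `F_R` is a cylinder observable on time-zero SPATIAL edges (so `F_R ∘ θ = F_R`,
`comp_timeReflectLG_eq`, and `rpCorr μ F_R t = Cov_μ(F_R, F_R∘α_t)`), continuous, and bounded by `#[-R,R]⁴ = (2R+1)⁴` (each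
normalised loop character is `≤ 1` in absolute value, `abs_normalisedCharacter_le_one`); weak convergence of the torus states along
the subsequence defining `μ` on the bounded continuous cylinder observables `F_R`, `F_R∘α_R`, `F_R·(F_R∘α_R)` (the definition of
`infiniteVolumeLimitPoints`), closedness of `≤` under limits — verbatim the tree's kernel glue
`massGapUpperRateOf_of_uniformTorusPlaquetteCorr` with the plaquette cost replaced by `F_R`.

HONEST LABEL.  Bookkeeping for the RECORD-label rung line `SoftLoopLongLag` (R2xi-G, leaf `WeakCouplingRates.XiPow` = an UPPER bound
on the lattice mass gap); NOT the Clay mass gap; no summit statement is touched.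

References: E. Seiler, LNP 159 (1982) Ch. 2 (thermodynamic limit on local observables); S. Chatterjee, arXiv:1803.01950 §2.
-/

set_option autoImplicit false

noncomputable section

open MeasureTheory Filter Topology SimpleGraph
open Literature.Probability.LatticeModels (Site box mem_box card_box)
open Literature.MathematicalPhysics Literature.MathematicalPhysics.QuantumFieldTheory
open Literature.MathematicalPhysics.QuantumLattice
open Summit.QuantumFields.YangMills.Theorems.WeakCouplingRates

namespace Summit.QuantumFields.YangMills.Theorems.SoftLoopLongLag

variable {G : Type} [Group G] [TopologicalSpace G] [IsTopologicalGroup G] [CompactSpace G]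
  [MeasurableSpace G] [BorelSpace G]

/-! ### The soft-loop observable: support, continuity, bound, reflection invariance -/

/-- Along a lattice walk none of whose darts points in direction `k`, the `k`-th coordinate of every visited site equals that of the
base point (route-independent copy of the bookkeeping in `SoftLoopLongLagSoftLoopObsPosTime`, kept out of the Theses cone). -/
theorem coord_eq_of_mem_support_of_dartDir_ne {d : ℕ} {k : Fin d} :
    ∀ {x y : Site d} (w : (Literature.Probability.LatticeModels.zdGraph d).Walk x y), (∀ e ∈ w.darts, dartDir e ≠ k) →
      ∀ v ∈ w.support, v k = x k
  | x, _, .nil, _, v, hv => by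
      rw [Walk.support_nil, List.mem_singleton] at hv
      rw [hv]
  | x, y, .cons (v := z) h w', hdir, v, hv => by
      rw [Walk.support_cons, List.mem_cons] at hv
      rcases hv with rfl | hv
      · rfl
      · have hd0 : dartDir (⟨(x, z), h⟩ : (Literature.Probability.LatticeModels.zdGraph d).Dart) ≠ k :=
          hdir _ (by rw [Walk.darts_cons]; exact List.mem_cons_self)
        have hzk : z k = x k := by
          rcases dartDir_spec (⟨(x, z), h⟩ : (Literature.Probability.LatticeModels.zdGraph d).Dart) with hz | hz
          · change z = x + _ at hz
            rw [hz, Pi.add_apply, Pi.single_eq_of_ne hd0.symm, add_zero]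
          · change x = z + _ at hz
            rw [hz, Pi.add_apply, Pi.single_eq_of_ne hd0.symm, add_zero]
        have hw' : ∀ e ∈ w'.darts, dartDir e ≠ k := fun e he =>
          hdir e (by rw [Walk.darts_cons]; exact List.mem_cons_of_mem _ he)
        rw [coord_eq_of_mem_support_of_dartDir_ne w' hw' v hv, hzk]

/-- The edge under a dart of such a walk is based at a site with the same `k`-th coordinate as the base point. -/
theorem dartStep_coord_eq {d : ℕ} {k : Fin d} {x y : Site d} (w : (Literature.Probability.LatticeModels.zdGraph d).Walk x y)
    (hw : ∀ e ∈ w.darts, dartDir e ≠ k) {e : (Literature.Probability.LatticeModels.zdGraph d).Dart} (he : e ∈ w.darts) :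
    (dartStep e).1.1 k = x k := by
  unfold dartStep
  split_ifs
  · exact coord_eq_of_mem_support_of_dartDir_ne w hw _ (w.dart_fst_mem_support_of_mem_darts he)
  · exact coord_eq_of_mem_support_of_dartDir_ne w hw _ (w.dart_snd_mem_support_of_mem_darts he)

/-- Every edge under a dart of the spatial loop `rectWalk x 1 2 R T` of `ℤ⁴` is based at a site with time coordinate `x 0`. -/
theorem dartStep_rectWalk_time (x : Site 4) (R T : ℕ) {e : (Literature.Probability.LatticeModels.zdGraph 4).Dart}
    (he : e ∈ (rectWalk x 1 2 R T).darts) : (dartStep e).1.1 0 = x 0 := by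
  refine dartStep_coord_eq (rectWalk x 1 2 R T) (fun e' he' => ?_) he
  rcases isPlanarIn_rectWalk x 1 2 R T e' he' with h | h <;> rw [h] <;> decide

omit [TopologicalSpace G] [IsTopologicalGroup G] [CompactSpace G] [MeasurableSpace G] [BorelSpace G] in
/-- The direction of the edge under a dart is the dart's direction. -/
theorem dartStep_fst_snd_eq_dartDir {d : ℕ} (e : (Literature.Probability.LatticeModels.zdGraph d).Dart) :
    (dartStep e).1.2 = dartDir e := by
  unfold dartStep
  split_ifs <;> rfl

omit [IsTopologicalGroup G] [CompactSpace G] [MeasurableSpace G] [BorelSpace G] in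
/-- `softLoopObs r R` is a cylinder observable on the edges under the darts of its loops, all of which are SPATIAL edges in the time-zero
hyperplane. -/
theorem softLoopObs_support (r : LatticeRep G) (R : ℕ) :
    IsCylinder (softLoopObs r R)
        ((timeZeroCube R).biUnion fun x => ((rectWalk x 1 2 R R).darts.map fun e => (dartStep e).1).toFinset) ∧
      ∀ e ∈ (timeZeroCube R).biUnion fun x => ((rectWalk x 1 2 R R).darts.map fun e => (dartStep e).1).toFinset,
        e.1 0 = 0 ∧ e.2 ≠ 0 := by
  refine ⟨?_, ?_⟩
  · intro U V hUV
    refine Finset.sum_congr rfl fun x hx => ?_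
    refine isCylinder_wilsonLoopObs _ (rectWalk x 1 2 R R) (fun e he => hUV e ?_)
    simp only [timeZeroCube, Finset.coe_biUnion, Finset.mem_coe, Set.mem_iUnion]
    exact ⟨x, hx, he⟩
  · intro e he
    simp only [timeZeroCube, Finset.mem_biUnion, List.mem_toFinset, List.mem_map] at he
    obtain ⟨x, hx, e', he', rfl⟩ := he
    have hx0 : x 0 = 0 := (Finset.mem_filter.1 hx).2
    refine ⟨by rw [dartStep_rectWalk_time x R R he', hx0], ?_⟩
    rw [dartStep_fst_snd_eq_dartDir]
    rcases isPlanarIn_rectWalk x 1 2 R R e' he' with h | h <;> rw [h] <;> decide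

omit [CompactSpace G] [MeasurableSpace G] [BorelSpace G] in
/-- `softLoopObs r R` is continuous. -/
theorem continuous_softLoopObs (r : LatticeRep G) (R : ℕ) : Continuous (softLoopObs r R) :=
  continuous_finsetSum _ fun x _ => continuous_wilsonLoopObs (continuous_normalisedCharacter_comp r.continuous) (rectWalk x 1 2 R R)

omit [MeasurableSpace G] [BorelSpace G] in
/-- `|softLoopObs r R| ≤ (2R+1)⁴`: at most `#[-R,R]⁴` loops, each normalised character `≤ 1` in absolute value. -/
theorem abs_softLoopObs_le (r : LatticeRep G) (R : ℕ) (U : LGConfig 4 G) :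
    |softLoopObs r R U| ≤ ((2 * R + 1 : ℕ) : ℝ) ^ 4 := by
  have hterm : ∀ x : Site 4,
      |wilsonLoopObs (fun g : G => (r.N : ℝ)⁻¹ * (r.ρ g).trace.re) (rectWalk x 1 2 R R) U| ≤ 1 := fun x =>
    StringTension.abs_normalisedCharacter_le_one r.ρ r.continuous _
  have hcard : (((box 4 R).filter (fun x : Site 4 => x 0 = 0)).card : ℝ) ≤ ((2 * R + 1 : ℕ) : ℝ) ^ 4 := by
    have h := Finset.card_filter_le (box 4 R) (fun x : Site 4 => x 0 = 0)
    rw [card_box] at h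
    exact_mod_cast h
  calc |softLoopObs r R U|
      ≤ ∑ x ∈ (box 4 R).filter (fun x : Site 4 => x 0 = 0),
          |wilsonLoopObs (fun g : G => (r.N : ℝ)⁻¹ * (r.ρ g).trace.re) (rectWalk x 1 2 R R) U| :=
        Finset.abs_sum_le_sum_abs _ _
    _ ≤ ∑ _x ∈ (box 4 R).filter (fun x : Site 4 => x 0 = 0), (1 : ℝ) := Finset.sum_le_sum fun x _ => hterm x
    _ = (((box 4 R).filter (fun x : Site 4 => x 0 = 0)).card : ℝ) := by simp
    _ ≤ ((2 * R + 1 : ℕ) : ℝ) ^ 4 := hcard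

omit [IsTopologicalGroup G] [CompactSpace G] [MeasurableSpace G] [BorelSpace G] in
/-- `softLoopObs r R` is invariant under the site time-reflection `θ` (a time-zero spatial cylinder observable). -/
theorem softLoopObs_timeReflect (r : LatticeRep G) (R : ℕ) (U : LGConfig 4 G) :
    softLoopObs r R (timeReflectLG U) = softLoopObs r R U :=
  comp_timeReflectLG_eq (softLoopObs_support r R).1 (softLoopObs_support r R).2 U

omit [IsTopologicalGroup G] [CompactSpace G] [BorelSpace G] in
/-- For every state `μ`, `rpCorr μ F_R t = lagCov μ F_R t` (`F_R ∘ θ = F_R`). -/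
theorem rpCorr_softLoopObs_eq_lagCov (r : LatticeRep G) (R : ℕ) (μ : Measure (LGConfig 4 G)) (t : ℕ) :
    rpCorr μ (softLoopObs r R) t = lagCov μ (softLoopObs r R) t := by
  simp only [rpCorr, lagCov, softLoopObs_timeReflect]

/-! ### The stub -/

/-- **K5 `stub_limitPassageG` (registered stub of crux `SoftLoopLagFloorToTorus`, line `birth`), PROVED.**  An eventual (in the torus
side) floor `θ ≤ torusLagCov r β L F_R R` passes to every torus-limit state `μ` at coupling `β` as `θ ≤ rpCorr μ F_R R`, together with the
ceiling `rpCorr μ F_R 0 ≤ (2R+1)⁸` — weak convergence on the bounded continuous cylinder observables `F_R`, `F_R∘α_R`, `F_R·(F_R∘α_R)` and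
`F_R∘θ = F_R`.  Bookkeeping for a RECORD-label rung line (R2xi-G); NOT the Clay mass gap. -/
theorem stub_limitPassageG :
    ∀ (G : Type) [Group G] [TopologicalSpace G] [IsTopologicalGroup G] [CompactSpace G] [MeasurableSpace G] [BorelSpace G]
      (r : LatticeRep G) (β θ : ℝ) (R : ℕ),
      (∀ᶠ L : ℕ in atTop, θ ≤ torusLagCov r β L (softLoopObs r R) R) →
      ∀ μ ∈ infiniteVolumeLimitPoints (d := 4) r.ρ β,
        θ ≤ rpCorr μ (softLoopObs r R) R ∧ rpCorr μ (softLoopObs r R) 0 ≤ ((2 * R + 1 : ℕ) : ℝ) ^ 8 := by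
  intro G _ _ _ _ _ _ r β θ R hev μ hμ
  set F : LGConfig 4 G → ℝ := softLoopObs r R with hFdef
  set C : ℝ := ((2 * R + 1 : ℕ) : ℝ) ^ 4 with hCdef
  obtain ⟨hcyl, -⟩ := softLoopObs_support r R
  have hcont : Continuous F := continuous_softLoopObs r R
  have hC : ∀ U, |F U| ≤ C := abs_softLoopObs_le r R
  obtain ⟨Lk, hmono, hprob, hlim⟩ := hμ
  haveI := hprob
  have hcylG := isCylinder_timeShift hcyl R
  have hcontG : Continuous fun U => F (timeShiftLG (G := G) R U) := hcont.comp (continuous_timeShiftLG R)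
  have hbdG : ∃ C', ∀ U : LGConfig 4 G, |F (timeShiftLG (G := G) R U)| ≤ C' := ⟨C, fun U => hC _⟩
  have hbdP : ∃ C', ∀ U : LGConfig 4 G, |F U * F (timeShiftLG (G := G) R U)| ≤ C' :=
    ⟨C * C, fun U => by
      rw [abs_mul]
      exact mul_le_mul (hC _) (hC _) (abs_nonneg _) ((abs_nonneg _).trans (hC U))⟩
  have tF := hlim F _ hcyl hcont ⟨C, hC⟩
  have tG := hlim _ _ hcylG hcontG hbdG
  have tP := hlim _ _ (IsCylinder.mul hcyl hcylG) (hcont.mul hcontG) hbdP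
  have hev' : ∀ᶠ k : ℕ in atTop,
      θ ≤ wilsonExpectation (L := Lk k + 1) r.ρ β
            (toTorusObservable (Lk k + 1) fun U => F U * F (timeShiftLG (G := G) R U)) -
          wilsonExpectation (L := Lk k + 1) r.ρ β (toTorusObservable (Lk k + 1) F) *
            wilsonExpectation (L := Lk k + 1) r.ρ β
              (toTorusObservable (Lk k + 1) fun U => F (timeShiftLG (G := G) R U)) :=
    (hmono.tendsto_atTop.eventually hev).mono fun k hk => by simpa only [torusLagCov] using hk
  have hcov : θ ≤ (∫ U, F U * F (timeShiftLG (G := G) R U) ∂μ) -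
      (∫ U, F U ∂μ) * (∫ U, F (timeShiftLG (G := G) R U) ∂μ) :=
    ge_of_tendsto (tP.sub (tF.mul tG)) hev'
  refine ⟨?_, ?_⟩
  · rw [rpCorr_softLoopObs_eq_lagCov]
    exact hcov
  · rw [rpCorr_softLoopObs_eq_lagCov]
    simp only [lagCov, timeShiftLG_zero]
    have h1 : (∫ U, F U * F U ∂μ) ≤ C ^ 2 := by
      have hb : ∀ᵐ U ∂μ, ‖F U * F U‖ ≤ C ^ 2 := ae_of_all _ fun U => by
        rw [Real.norm_eq_abs, abs_mul, sq]
        exact mul_le_mul (hC _) (hC _) (abs_nonneg _) ((abs_nonneg _).trans (hC U))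
      have := norm_integral_le_of_norm_le_const hb
      rw [probReal_univ, mul_one, Real.norm_eq_abs] at this
      exact (le_abs_self _).trans this
    have hC2 : C ^ 2 = ((2 * R + 1 : ℕ) : ℝ) ^ 8 := by rw [hCdef]; ring
    nlinarith [mul_self_nonneg (∫ U, F U ∂μ)]

end Summit.QuantumFields.YangMills.Theorems.SoftLoopLongLag

end
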